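import Summits.ResolutionOfSingularities.ResolutionOfSingularities.Theorems.MarkedTransferCampaignW46MohWindowShadeFormalAnchor
import HarnessLib

/-!
# [OURS · L1 W4.6 rung (iii-2), FORMAL ENTRANCE DOOR, brick 2a] The RING-LEVEL formal step: the controlled transform of a formal anchor
# at a rational point of the point blow-up is the formal anchor of the model's `PointBlowup.step`, at an EQUIMULTIPLE point

Cell `res-hironaka`, LADDER-RESOLUTION rung L (D-0089), slot W4.6 rung (iii); seat res-L1-s46-pv-6 (gen 5). Host route MarkedTransfer,
`--supports stmt-ResolutionOfSingularities-16155 --as helper`; kind proof (no definition).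

WHAT. `g : R → L` a local homomorphism of Noetherian local rings (the stalk map of a point blow-up at a rational point), `E₀ : R̂ ≅ K⟦z, u₀, u₁⟧`
Cohen coordinates with an adapted system `c` of generators of `𝔪_R` (res-L1-s46-pv-2's brick 13), ring-level chart data at the point in the
chart `u_{i₀}` (pv-2's bricks 4/6: quotients `e_j`, values `τ_j`, `𝔪_L = (g c_{i₀}, e_j − g τ_j)`, residual rationality), the Hauser–Wagner
frame condition (chart `u₁` only at its origin), a FORMAL ANCHOR `E₀(f₀) = w₀ · (z^p + F(u₀, u₁))` (all monomials of `F` of degree `≥ p`)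
and the controlled transform `g f₀ = g(c_{i₀})^p · f′` with `f′ ∈ 𝔪_L^p` (the point is SINGULAR). THEN (`exists_ringEquiv_transform_anchor`)
there are Cohen coordinates `E′ : L̂ ≅ K⟦z, u₀, u₁⟧` with `E′(f′) = w′ · (z^p + F′(u₀, u₁))`, `F′ = (PointBlowup.step p i₀ b s).F` the MODEL
STEP at the translated point `b = (i₀ ↦ 0, i₁ ↦ τ_{i₁}(0))`, and `b` is an EQUIMULTIPLE point of the model. Proof = pv-2's
`exists_ringEquiv_transform_atom` pattern: formal-chart recognition WITH THE CLEANING SHEAR chosen from `exists_add_pow_eq_deletePthPowers`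
(`FormalChart.exists_ringEquiv_completion_chart_shear`), this seat's polynomial identity `MohWindowShadeAnchorCore.map_anchor_eq_mul_pointTransform`,
`E′(g c_{i₀}) = u_{i₀} · unit` (`AtomGerm.exists_isUnit_image_adapted`), cancellation of `u_{i₀}^p`; singularity of the point kills the
constant of the cleaning polynomial and gives equimultiplicity (`MohWindowShadeAnchorCore.isEquimultiplePoint_of_le_ordZero_add_C`).
§1: cleaning kills constants. `K : Type` (universe of pv-2's dictionary).

HONEST FRAMING. Nothing here is a statement of H. Hironaka's manuscript [Hironaka2017] (Def. 2.1 p.5, Th. 16.6 p.84 — scope only, under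
adjudication) and nothing asserts that any statement of it holds. AI-written; AI review is weaker than expert review. No `sorry`; axioms
standard. References: H. Matsumura, *Commutative Ring Theory* (1986), Thm. 8.11; H. Hauser, Bull. AMS 47 (2010) §§F–G. [Matsumura1987]
[Hauser2010] [folklore]
-/

noncomputable section

set_option linter.dupNamespace false -- mandated namespace of this single-conjunct summit

open IsLocalRing MvPolynomial

namespace Summit.ResolutionOfSingularities.ResolutionOfSingularities.Theorems

namespace CampaignW46

namespace MohWindowShadeFormalStep

open Literature.AlgebraicGeometry.Resolution
open Literature.AlgebraicGeometry.Resolution.PointBlowup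
open Literature.AlgebraicGeometry.Resolution.Hauser2010
open Literature.Barriers.ResolutionOfSingularities.HauserPerlega (natCast_le_ordZero_iff ordZero_ne_top ordZero_rename)
open CampaignW46.FormalChart
open CampaignW46.AtomGerm (hasSubst_chartGerm ringHom_eq_subst_chartGerm rename_chartSubst_self rename_chartSubst_of_ne
  exists_isUnit_image_adapted X_some_ne_zero kill_rename_some constantCoeff_rename_some mem_maximalIdeal_pow_iff_algebraMap)
open Literature.RingTheory.MvPowerSeries.Jets (mem_maximalIdeal_iff_constantCoeff_eq_zero)
open Summit.ResolutionOfSingularities.ResolutionOfSingularities.Theorems.FrobeniusClosing (chartSubst)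
open MohWindowShadeFormalAnchor (frame_apply isRegularLocalRing_S spanFinrank_S span_frame_eq_maximalIdeal eval₂_frame_eq_rename)
/-! ## §1 Cleaning bookkeeping: constants are `p`-th power monomials -/

section Cleaning

variable {K : Type} [Field K] {σ : Type} [DecidableEq σ] (p : ℕ)

omit [DecidableEq σ] in
/-- The zero exponent is a `p`-th power exponent. [cite: Hauser2010, §I (definition of oblique, "p-th power monomials")] -/
theorem isPthPowerExponent_zero : IsPthPowerExponent p (0 : σ →₀ ℕ) := fun i _ => by simp

/-- Cleaning kills constants: `clean(P + C u) = clean(P)`. [cite: Hauser2010, §G (cleaning of p-th power monomials)] -/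
theorem deletePthPowers_add_C (P : MvPolynomial σ K) (u : K) : deletePthPowers p (P + C u) = deletePthPowers p P := by
  classical
  ext d
  rw [coeff_deletePthPowers, coeff_deletePthPowers, coeff_add, coeff_C]
  by_cases hd : (0 : σ →₀ ℕ) = d
  · subst hd; rw [if_pos (isPthPowerExponent_zero p), if_pos (isPthPowerExponent_zero p)]
  · rw [if_neg hd, add_zero]

/-- A cleaned polynomial has no constant term. [cite: Hauser2010, §G (cleaning of p-th power monomials)] -/
theorem coeff_zero_deletePthPowers (P : MvPolynomial σ K) : coeff 0 (deletePthPowers p P) = 0 := by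
  classical
  rw [coeff_deletePthPowers, if_pos (isPthPowerExponent_zero p)]

end Cleaning

/-! ## §2 The transform of a formal anchor at a rational point of the point blow-up (ring level) -/

section Transform

variable {p : ℕ} [hp : Fact p.Prime] {K : Type} [Field K] [CharP K p] [PerfectRing K p] [DecidableEq K]
  {R : Type} [CommRing R] [IsLocalRing R] [IsNoetherianRing R]
  {L : Type} [CommRing L] [IsLocalRing L] [IsNoetherianRing L]
  (g : R →+* L) (hg : (maximalIdeal R).map g ≤ maximalIdeal L)
  (E₀ : AdicCompletion (maximalIdeal R) R ≃+* MvPowerSeries (Option (Fin 2)) K)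
  (c : Option (Fin 2) → R) (hc : Ideal.span (Set.range c) = maximalIdeal R)
  (hcX : ∀ j, E₀ (algebraMap R (AdicCompletion (maximalIdeal R) R) (c j)) - MvPowerSeries.X j ∈
    maximalIdeal (MvPowerSeries (Option (Fin 2)) K) ^ 2)
  {i₀ i₁ : Fin 2} (hi : i₁ ≠ i₀) (htwo : ∀ l, l = i₀ ∨ l = i₁)
  (e : Option (Fin 2) → L) (he : ∀ j, g (c j) = g (c (some i₀)) * e j)
  (τ : Option (Fin 2) → R)
  (hgen : Ideal.span (Set.range fun j : Option (Fin 2) =>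
    if j = some i₀ then g (c (some i₀)) else e j - g (τ j)) = maximalIdeal L)
  (hres : ∀ y : L, ∃ r : R, y - g r ∈ maximalIdeal L)
  (hdim : (Fintype.card (Option (Fin 2)) : WithBot ℕ∞) ≤ ringKrullDim L)

omit hp [CharP K p] [PerfectRing K p] [DecidableEq K] in
/-- The frame with the exceptional letter first equals the placing `y_l ↦ u_l`. [folklore] -/
theorem frame_chart_eq (i₀ i₁ : Fin 2) (hi : i₁ ≠ i₀) (htwo : ∀ l, l = i₀ ∨ l = i₁) :
    (fun l : Fin 2 => if l = i₀ then (MvPowerSeries.X (some i₀) : MvPowerSeries (Option (Fin 2)) K) else MvPowerSeries.X (some i₁)) =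
      fun l : Fin 2 => if l = (0 : Fin 2) then MvPowerSeries.X (some (0 : Fin 2)) else MvPowerSeries.X (some 1) := by
  funext l
  have h01 : ∀ m : Fin 2, (if m = (0 : Fin 2) then (MvPowerSeries.X (some (0 : Fin 2)) : MvPowerSeries (Option (Fin 2)) K)
      else MvPowerSeries.X (some 1)) = MvPowerSeries.X (some m) := fun m => frame_apply K m
  rw [h01]
  rcases htwo l with rfl | rfl
  · rw [if_pos rfl]
  · rw [if_neg hi]

omit hp [CharP K p] [PerfectRing K p] [DecidableEq K] in
/-- In `K⟦z, u₀, u₁⟧`: a polynomial `P(u₀, u₁)` in `𝔪^n` has all its monomials of degree `≥ n` (quasi-regularity of the variables).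
[cite: Matsumura1987, Thm. 16.2 (i)] -/
theorem natCast_le_ordZero_of_frame_mem_pow {P : MvPolynomial (Fin 2) K} {n : ℕ}
    (h : eval₂ MvPowerSeries.C (fun l : Fin 2 => if l = (0 : Fin 2) then (MvPowerSeries.X (some (0 : Fin 2)) : MvPowerSeries (Option (Fin 2)) K)
      else MvPowerSeries.X (some 1)) P ∈ maximalIdeal (MvPowerSeries (Option (Fin 2)) K) ^ n) :
    (n : ℕ∞) ≤ ordZero P := by
  classical
  rw [← ordZero_rename (MohWindowShadeAnchor.frame_rename_injective (j := (0 : Fin 2)) (i := 1) (by decide)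
    (fun l => by fin_cases l <;> simp))]
  refine MohWindowShadeAnchor.natCast_le_ordZero_of_eval₂_mem_pow (isRegularLocalRing_S K) (spanFinrank_S K)
    (span_frame_eq_maximalIdeal K) MvPowerSeries.C ?_
  rwa [MohWindowShadeAnchor.eval₂_rename_frame]

include hg hc he hcX hgen hres hdim hi htwo in
/-- [OURS · L1 W4.6 rung (iii-2) — FORMAL ENTRANCE DOOR, the ring-level step; replaces the role of «the transform `E′` of `E` by the blowup
with center `D`» (H. Hironaka, ms. 2017, Def. 2.1 p.5) for a formally anchored purely inseparable window germ at a rational point of the point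
blow-up; NOT a statement of the manuscript] **The controlled transform of a formal anchor is the formal anchor of the model's step.**
`g : R → L` local (the stalk map of the blow-up), `E₀` Cohen coordinates at the centre with an adapted system `c` of generators of `𝔪_R`,
chart data at the rational point upstairs in the chart `u_{i₀}` (quotients `e_j`, values `τ_j`), the Hauser–Wagner frame condition (the
chart `u_1` only at its origin: `τ_{u_0}(0) = 0` if `i₀ = 1`), the anchor `E₀(f₀) = w₀ · (z^p + F(u))` with all monomials of `F` of degree
`≥ p`, and the controlled transform `g f₀ = g(c_{i₀})^p · f′` with `f′ ∈ 𝔪_L^p` (the point upstairs is SINGULAR). Then there are Cohen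
coordinates `E′` at the point with `E′(f′) = w′ · (z^p + F′(u))`, `F′ = (PointBlowup.step p i₀ b s).F` the model's step at the translated point
`b = (i₀ ↦ 0, i₁ ↦ τ_{i₁}(0))`, and `b` is an EQUIMULTIPLE point of the model. Pattern of res-L1-s46-pv-2's `exists_ringEquiv_transform_atom`
(formal-chart recognition with the cleaning shear chosen from `exists_add_pow_eq_deletePthPowers`); the polynomial identity is this seat's
`MohWindowShadeAnchorCore.map_anchor_eq_mul_pointTransform`. [cite: Matsumura1987, Thm. 8.11] [cite: Hauser2010, §§F–G (point blowup followed by cleaning)] -/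
theorem exists_ringEquiv_transform_anchor (s : State (Fin 2) K) (hdeg : ∀ d ∈ s.F.support, p ≤ d.degree) (f₀ : R)
    (w₀ : MvPowerSeries (Option (Fin 2)) K) (hw₀ : IsUnit w₀)
    (hf₀ : E₀ (algebraMap R (AdicCompletion (maximalIdeal R) R) f₀) =
      w₀ * (MvPowerSeries.X none ^ p + eval₂ MvPowerSeries.C (fun l : Fin 2 => if l = (0 : Fin 2) then MvPowerSeries.X (some (0 : Fin 2)) else MvPowerSeries.X (some 1)) s.F))
    (hHW : i₀ = 1 → MvPowerSeries.constantCoeff (E₀ (algebraMap R (AdicCompletion (maximalIdeal R) R) (τ (some 0)))) = 0)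
    (f' : L) (hf' : g f₀ = g (c (some i₀)) ^ p * f') (hf'𝔪 : f' ∈ maximalIdeal L ^ p) :
    ∃ (E' : AdicCompletion (maximalIdeal L) L ≃+* MvPowerSeries (Option (Fin 2)) K)
      (w' : MvPowerSeries (Option (Fin 2)) K) (b : Fin 2 → K), IsUnit w' ∧
      b i₀ = 0 ∧ (i₀ = 1 → ∀ l, b l = 0) ∧ b i₁ = MvPowerSeries.constantCoeff (E₀ (algebraMap R (AdicCompletion (maximalIdeal R) R) (τ (some i₁)))) ∧
      IsEquimultiplePoint p i₀ b s ∧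
      E' (algebraMap L (AdicCompletion (maximalIdeal L) L) f') =
        w' * (MvPowerSeries.X none ^ p + eval₂ MvPowerSeries.C (fun l : Fin 2 => if l = (0 : Fin 2) then MvPowerSeries.X (some (0 : Fin 2)) else MvPowerSeries.X (some 1))
          (step p i₀ b s).F) := by
  classical
  -- notation
  set ĝ := adicCompletionMap (maximalIdeal R) (maximalIdeal L) g hg with hĝ
  set φ : (MvPowerSeries (Option (Fin 2)) K) →+* AdicCompletion (maximalIdeal L) L := ĝ.comp E₀.symm.toRingHom with hφ
  set ofL := algebraMap L (AdicCompletion (maximalIdeal L) L) with hofL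
  set ofR := algebraMap R (AdicCompletion (maximalIdeal R) R) with hofR
  set τκ : Fin 2 → K := fun j => MvPowerSeries.constantCoeff (E₀ (ofR (τ (some j)))) with hτκ
  set ζ : K := MvPowerSeries.constantCoeff (E₀ (ofR (τ none))) with hζ
  set fr : Fin 2 → (MvPowerSeries (Option (Fin 2)) K) := fun l => if l = (0 : Fin 2) then MvPowerSeries.X (some (0 : Fin 2)) else MvPowerSeries.X (some 1) with hfr
  have hfrl : ∀ l, fr l = MvPowerSeries.X (some l) := fun l => frame_apply K l
  have hφE₀ : ∀ x, φ (E₀ x) = ĝ x := fun x => by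
    rw [hφ, RingHom.comp_apply]
    change ĝ (E₀.symm (E₀ x)) = ĝ x
    rw [RingEquiv.symm_apply_apply]
  have hĝ_of : ∀ x : R, ĝ (ofR x) = ofL (g x) := fun x => by
    rw [hofR, hofL, hĝ, adicCompletionMap_algebraMap]
  haveI : IsNoetherianRing (AdicCompletion (maximalIdeal L) L) := isNoetherianRing_adicCompletion_maximalIdeal L
  haveI : CharP (MvPowerSeries (Option (Fin 2)) K) p := charP_of_injective_algebraMap (algebraMap K (MvPowerSeries (Option (Fin 2)) K)).injective p
  -- the translated point in the Hauser–Wagner frame and the cleaning polynomial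
  set b : Fin 2 → K := fun l => if l = i₀ then 0 else τκ i₁ with hb
  have hbi₀ : b i₀ = 0 := by rw [hb]; exact if_pos rfl
  have hbi₁ : b i₁ = τκ i₁ := by rw [hb]; exact if_neg hi
  set PT := pointTransform p i₀ b s with hPT
  obtain ⟨Q, hQ⟩ := exists_add_pow_eq_deletePthPowers p 1 (PT + MvPolynomial.C (ζ ^ p))
  rw [pow_one, deletePthPowers_add_C] at hQ
  -- `hQ : PT + C (ζ^p) + Q ^ p = (step p i₀ b s).F`
  have hstepF : (step p i₀ b s).F = deletePthPowers p PT := rfl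
  rw [← hstepF] at hQ
  set q₀ : K := MvPolynomial.coeff 0 Q with hq₀
  -- the shear series: the placed polynomial `Q − q₀`
  set sh : (MvPowerSeries (Option (Fin 2)) K) := eval₂ MvPowerSeries.C fr (Q - MvPolynomial.C q₀) with hsh
  have hsh_ren : sh = MvPowerSeries.rename (some : Fin 2 → Option (Fin 2)) ((Q - MvPolynomial.C q₀ : MvPolynomial (Fin 2) K) :
      MvPowerSeries (Fin 2) K) := by rw [hsh]; exact eval₂_frame_eq_rename _
  have hsh0 : MvPowerSeries.constantCoeff sh = 0 := by
    rw [hsh_ren, constantCoeff_rename_some, ← MvPowerSeries.coeff_zero_eq_constantCoeff, MvPolynomial.coeff_coe, MvPolynomial.coeff_sub,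
      MvPolynomial.coeff_C, if_pos rfl, hq₀, sub_self]
  have hsh_kill : MvPowerSeries.subst (fun j : Option (Fin 2) => if j = none then (0 : (MvPowerSeries (Option (Fin 2)) K)) else MvPowerSeries.X j) sh = sh := by
    rw [hsh_ren]; exact kill_rename_some _
  -- STEP 1: the sheared chart `E'`
  obtain ⟨E', hE'C, hE'i, hE'j, hE'z⟩ :=
    exists_ringEquiv_completion_chart_shear g hg E₀ c hc hcX (some i₀) e he τ hgen hres hdim none
      (Option.some_ne_none i₀).symm sh hsh0 hsh_kill
  set ψ : (MvPowerSeries (Option (Fin 2)) K) →+* (MvPowerSeries (Option (Fin 2)) K) := (E' : _ →+* (MvPowerSeries (Option (Fin 2)) K)).comp φ with hψ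
  have hψapp : ∀ x, ψ x = E' (φ x) := fun x => rfl
  have hψC : ∀ l, ψ (MvPowerSeries.C l) = MvPowerSeries.C l := fun l => hE'C l
  have hψCring : ψ.comp MvPowerSeries.C = MvPowerSeries.C := RingHom.ext hψC
  have hψi : ψ (MvPowerSeries.X (some i₀)) = MvPowerSeries.X (some i₀) := hE'i
  have hψj : ψ (MvPowerSeries.X (some i₁)) = MvPowerSeries.X (some i₀) * (MvPowerSeries.X (some i₁) + MvPowerSeries.C (τκ i₁)) :=
    hE'j (some i₁) (fun h => hi (Option.some_injective _ h)) (Option.some_ne_none i₁)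
  have hψz : ψ (MvPowerSeries.X none) = MvPowerSeries.X (some i₀) * (MvPowerSeries.X none + sh + MvPowerSeries.C ζ) := by
    rw [hψapp, hE'z, hζ, hofR]; ring
  -- STEP 2: the anchor identity (this seat's AnchorCore (A)) for `ψ`
  have hfr_chart : (fun l : Fin 2 => if l = i₀ then (MvPowerSeries.X (some i₀) : (MvPowerSeries (Option (Fin 2)) K)) else MvPowerSeries.X (some i₁)) = fr := frame_chart_eq i₀ i₁ hi htwo
  have hA := MohWindowShadeAnchorCore.map_anchor_eq_mul_pointTransform p (σ := Fin 2) (c := i₀) (c' := i₁) hi htwo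
    (MvPowerSeries.C : K →+* (MvPowerSeries (Option (Fin 2)) K)) ψ fr (MvPowerSeries.X none) s hdeg (τκ i₁) ζ (X' := MvPowerSeries.X (some i₀)) (V := MvPowerSeries.X (some i₁)) (W := MvPowerSeries.X none + sh)
    (by rw [hfrl]; exact hψi) (by rw [hfrl, hψC]; exact hψj) (by rw [hψC, hψz])
  rw [hψCring, hfr_chart] at hA
  -- `hA : ψ (z^p + F(fr)) = X_{i₀}^p * ((z + sh)^p + (PT + C ζ^p)(fr))`; rewrite the bracket as `z^p + F'(fr) − C (q₀^p)`
  have hbracket : (MvPowerSeries.X none + sh) ^ p + eval₂ MvPowerSeries.C fr (PT + MvPolynomial.C (ζ ^ p)) =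
      MvPowerSeries.X none ^ p + eval₂ MvPowerSeries.C fr (step p i₀ b s).F - MvPowerSeries.C (q₀ ^ p) := by
    rw [← hQ, hsh]
    simp only [MvPolynomial.eval₂_add, MvPolynomial.eval₂_pow, MvPolynomial.eval₂_sub, MvPolynomial.eval₂_C, add_pow_char, sub_pow_char, map_pow]
    ring
  rw [hbracket] at hA
  obtain ⟨G, hG⟩ : ∃ G : MvPowerSeries (Option (Fin 2)) K,
      G = MvPowerSeries.X none ^ p + eval₂ MvPowerSeries.C fr (step p i₀ b s).F - MvPowerSeries.C (q₀ ^ p) := ⟨_, rfl⟩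
  rw [← hG] at hA
  -- STEP 3: `E′ (g f₀) = ψ(w₀) · X_{i₀}^p · G`
  have hEgf₀ : E' (ofL (g f₀)) = ψ w₀ * (MvPowerSeries.X (some i₀) ^ p * G) := by
    rw [← hĝ_of, ← hφE₀, ← hψapp, hf₀, map_mul, hA]
  -- STEP 4: `E′ (g c_{i₀}) = X_{i₀} · unit` — `ψ` is the germ chart substitution
  set r : MvPowerSeries (Fin 2) K := ((Q - MvPolynomial.C q₀ : MvPolynomial (Fin 2) K) : MvPowerSeries (Fin 2) K) + MvPowerSeries.C ζ
    with hr
  have hψz' : ψ (MvPowerSeries.X none) = MvPowerSeries.X (some i₀) * (MvPowerSeries.X none + MvPowerSeries.rename (some : Fin 2 → Option (Fin 2)) r) := by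
    rw [hψz, hr, map_add, ← hsh_ren, MvPowerSeries.rename_C]; ring
  have hψj' : ∀ j : Fin 2, j ≠ i₀ → ψ (MvPowerSeries.X (some j)) = MvPowerSeries.X (some i₀) * (MvPowerSeries.X (some j) + MvPowerSeries.C (τκ j)) := by
    intro j hj
    rcases htwo j with rfl | rfl
    · exact absurd rfl hj
    · exact hψj
  set σ' : Option (Fin 2) → (MvPowerSeries (Option (Fin 2)) K) := fun o => o.elim (MvPowerSeries.X (some i₀) * (MvPowerSeries.X none + MvPowerSeries.rename (some : Fin 2 → Option (Fin 2)) r))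
    (fun j => MvPowerSeries.rename (some : Fin 2 → Option (Fin 2)) (chartSubst 2 K i₀ τκ j)) with hσ'
  have hσ'sub : MvPowerSeries.HasSubst σ' := hasSubst_chartGerm i₀ τκ r
  have hψsubst : ∀ f, ψ f = MvPowerSeries.subst σ' f := fun f => ringHom_eq_subst_chartGerm ψ hψC i₀ τκ r hψi hψj' hψz' f
  have hσ'i : σ' (some i₀) = MvPowerSeries.X (some i₀) := rename_chartSubst_self i₀ τκ
  have hσ'mem : ∀ j, σ' j ∈ Ideal.span {(MvPowerSeries.X (some i₀) : (MvPowerSeries (Option (Fin 2)) K))} := by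
    intro j
    cases j with
    | none => exact Ideal.mul_mem_right _ _ (Ideal.subset_span rfl)
    | some k =>
      by_cases hk : k = i₀
      · subst hk; rw [hσ'i]; exact Ideal.subset_span rfl
      · change MvPowerSeries.rename some (chartSubst 2 K i₀ τκ k) ∈ _
        rw [rename_chartSubst_of_ne i₀ τκ hk]
        exact Ideal.mul_mem_right _ _ (Ideal.subset_span rfl)
  obtain ⟨w₂, hw₂, hEci⟩ : ∃ w₂ : (MvPowerSeries (Option (Fin 2)) K), IsUnit w₂ ∧ E' (ofL (g (c (some i₀)))) = MvPowerSeries.X (some i₀) * w₂ := by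
    obtain ⟨w₂, hw₂, h⟩ := exists_isUnit_image_adapted i₀ hσ'sub hσ'i hσ'mem (E₀ (ofR (c (some i₀)))) (hcX (some i₀))
    exact ⟨w₂, hw₂, by rw [← hĝ_of, ← hφE₀, ← hψapp, hψsubst, h]⟩
  have hw₀' : IsUnit (ψ w₀) := hw₀.map ψ
  -- STEP 5: cancel `X_{i₀}^p`: `w₂^p · E′ f′ = ψ(w₀) · G`
  have hEf' : w₂ ^ p * E' (ofL f') = ψ w₀ * G := by
    have h1 : E' (ofL (g f₀)) = (MvPowerSeries.X (some i₀) * w₂) ^ p * E' (ofL f') := by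
      rw [hf', map_mul, map_pow, map_mul, map_pow, hEci]
    have h2 : (MvPowerSeries.X (some i₀) : (MvPowerSeries (Option (Fin 2)) K)) ^ p * (w₂ ^ p * E' (ofL f')) = MvPowerSeries.X (some i₀) ^ p * (ψ w₀ * G) := by
      rw [← mul_assoc, ← mul_pow, ← h1, hEgf₀]; ring
    exact mul_left_cancel₀ (pow_ne_zero p (X_some_ne_zero i₀)) h2
  -- STEP 6: singularity upstairs: `G ∈ 𝔪^p`, hence `q₀ = 0` and the point is equimultiple
  have hG𝔪 : G ∈ maximalIdeal (MvPowerSeries (Option (Fin 2)) K) ^ p := by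
    have h1 : E' (ofL f') ∈ maximalIdeal (MvPowerSeries (Option (Fin 2)) K) ^ p :=
      ringEquiv_mem_maximalIdeal_pow E' ((mem_maximalIdeal_pow_iff_algebraMap p f').mp hf'𝔪)
    have h2 : ψ w₀ * G ∈ maximalIdeal (MvPowerSeries (Option (Fin 2)) K) ^ p := by rw [← hEf']; exact Ideal.mul_mem_left _ _ h1
    exact (Ideal.unit_mul_mem_iff_mem _ hw₀').mp h2
  have hp1 : 1 ≤ p := hp.out.one_lt.le
  have hXp : (MvPowerSeries.X none : (MvPowerSeries (Option (Fin 2)) K)) ^ p ∈ maximalIdeal (MvPowerSeries (Option (Fin 2)) K) ^ p :=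
    Ideal.pow_mem_pow (mem_maximalIdeal_iff_constantCoeff_eq_zero.mpr (MvPowerSeries.constantCoeff_X _)) p
  have hq₀0 : q₀ ^ p = 0 := by
    -- constant coefficients: `G(0) = 0`, `z^p(0) = 0`, `F′(fr)(0) = F′(0) = 0` (cleaned)
    have hG0 : MvPowerSeries.constantCoeff G = 0 :=
      mem_maximalIdeal_iff_constantCoeff_eq_zero.mp (Ideal.pow_le_self hp.out.ne_zero hG𝔪)
    have hF'0 : MvPowerSeries.constantCoeff (eval₂ MvPowerSeries.C fr (step p i₀ b s).F) = 0 := by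
      rw [eval₂_frame_eq_rename, constantCoeff_rename_some, ← MvPowerSeries.coeff_zero_eq_constantCoeff, MvPolynomial.coeff_coe,
        hstepF, coeff_zero_deletePthPowers]
    rw [hG, map_sub, map_add, map_pow, MvPowerSeries.constantCoeff_X, zero_pow hp.out.ne_zero, zero_add, hF'0, zero_sub, MvPowerSeries.constantCoeff_C,
      neg_eq_zero] at hG0
    exact hG0
  have hGeq : G = MvPowerSeries.X none ^ p + eval₂ MvPowerSeries.C fr (step p i₀ b s).F := by
    rw [hG, hq₀0, map_zero, sub_zero]
  have hequi : IsEquimultiplePoint p i₀ b s := by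
    -- `(PT + C ζ^p)(fr) = G − z^p − sh^p + C q₀^p ∈ 𝔪^p`
    have hsh𝔪 : sh ^ p ∈ maximalIdeal (MvPowerSeries (Option (Fin 2)) K) ^ p := Ideal.pow_mem_pow (mem_maximalIdeal_iff_constantCoeff_eq_zero.mpr hsh0) p
    have hev : eval₂ MvPowerSeries.C fr (PT + MvPolynomial.C (ζ ^ p)) ∈ maximalIdeal (MvPowerSeries (Option (Fin 2)) K) ^ p := by
      have hx : eval₂ MvPowerSeries.C fr (PT + MvPolynomial.C (ζ ^ p)) = G - MvPowerSeries.X none ^ p - sh ^ p := by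
        rw [hG, ← hbracket, add_pow_char _ _ p]; ring
      rw [hx]
      exact Ideal.sub_mem _ (Ideal.sub_mem _ hG𝔪 hXp) hsh𝔪
    exact MohWindowShadeAnchorCore.isEquimultiplePoint_of_le_ordZero_add_C p (natCast_le_ordZero_of_frame_mem_pow hev)
  -- assemble
  obtain ⟨u₂, hu₂⟩ := hw₂.pow p
  refine ⟨E', ↑u₂⁻¹ * ψ w₀, b, (u₂⁻¹.isUnit).mul hw₀', hbi₀, fun h1 l => ?_, hbi₁, hequi, ?_⟩
  · rcases htwo l with rfl | hl
    · exact hbi₀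
    · rw [hl, hbi₁]
      -- `i₀ = 1`, so `i₁ = 0`: the Hauser–Wagner frame condition
      have hi₁ : i₁ = 0 := by
        apply Fin.ext
        have h2 := i₁.isLt
        have h3 : (i₁ : ℕ) ≠ (i₀ : ℕ) := fun h => hi (Fin.ext h)
        rw [h1] at h3
        change (i₁ : ℕ) ≠ 1 at h3
        change (i₁ : ℕ) = 0
        omega
      rw [hi₁]
      exact hHW h1
  · rw [mul_assoc, ← hGeq, ← hEf', ← hu₂, ← mul_assoc, Units.inv_mul, one_mul]

end Transform

end MohWindowShadeFormalStep

end CampaignW46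

end Summit.ResolutionOfSingularities.ResolutionOfSingularities.Theorems

end
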